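import Literature.NumberTheory.GelbartRogawski1991.DoubledWeilRepresentationUndoublingConjTransport
import Literature.NumberTheory.Automorphic.Liu2021.Def411WeilCarriersDoubling
import HarnessLib

/-!
# The χ-attached splitting at a second `V`-frame is the conjugated χ-attached splitting, and the Kronecker operator identity
# (cell `hodgecm-mathlib`, GS-6 (β) node (T), piece (4) `hω_of_T4` — GENERIC half; placement: A-plan1/A-plan2 word)

Setting: the CM doubling datum of ★ `DoubledUnitaryGlobalSplittingData` at two `V`-frames `dV`, `dV′` (same enumeration `e`, same
`W`-frame `dW`), the χ-attached compatible splittings `χSplitting[dV] = undoubleHom (doubledWeilRep[dV] χ)` of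
★ `Liu2021.Def411WeilCarriersDoubling` ([HarrisKudlaSweet1996]'s `ι̃_{V,χ}` "determined by doubling", [Liu2021, App. D Step 2]'s `ι_μ`),
and ABSTRACT conjugation data: doubled `(rD, CD, θD)` and undoubled `(r, C, θ)` with the compatibilities of
★ `DoubledWeilRepresentationUndoublingConjTransport.undouble_conjSplitting_comp` ((u1) `hθ`, the see-saw square `hsq`, (u2) `hrD`).

* §1 **`chiSplitting_eq_conjSplitting_of_doubled`** — IF the doubled χ-normalised Weil representations are conjugate,
  `conjSplitting rD CD hCD (doubledWeilRep[dV] χ ∘ θD) = doubledWeilRep[dV′] χ` (`hT4`; in the cell this is the `hcont`-free rigidity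
  theorem of the (T4) lineage), THEN so are the undoubled χ-attached splittings:
  `χSplitting[dV′] g′ = conjSplitting r C hC (χSplitting[dV] ∘ θ) g′` — ★ `undouble_conjSplitting_comp` at `sD := doubledWeilRep[dV] χ`,
  after transporting `undouble` along `hT4` (`undouble` depends on the doubled homomorphism only through its value).
* §2 the operator identities: **`omega_apply_omega_chiSplitting_of_eq_conjSplitting`** —
  `ω(r) ∘ ω(χSplitting[dV′] g′) = ω(χSplitting[dV] (θ g′)) ∘ ω(r)` on `𝒮(𝔸^n)` (★ `omega_apply_omega_conjSplitting`), and its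
  Kronecker-index form **`omega_kron_chiSplitting_of_eq_conjSplitting`** along `r = reindex_e rK` (★ `omega_reindex_apply`):
  `ω(rK) (R_e⁻¹ (ω(χSplitting[dV′] g′) (R_e Ψ))) = R_e⁻¹ (ω(χSplitting[dV] (θ g′)) (R_e (ω(rK) Ψ)))` — the shape of the `hω` clause of
  the frame-independence contract for `ω(μ,ε,χ)` (consumer: the (T) join `chiSplittingFrameTransport_of_model_pieces`).

The MODEL instantiation (doubled Kronecker matrix of a rational isometry `B⁻¹ ⊗ 1`, Weil's Θ-fixing lifts `rD`, `rKron`, `rneg`) is the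
companion wave-2 file over the (T1ᴰ) lineage.  Theorems only (no definition, no named fact); default heartbeats.
Phase-A bytes of record: `A-plan/gs6-glue/T-hOmegaOfT4.body.A-p18g9.lean` sha16 b42ece39d5c1cd7b (A-p18 g9) §1–§2, declarations
byte-identical up to (i) `undouble_congr` made `private`, (ii) the local notation `𝔸⁺` expanded (no notation in a Literature file).
HC_CM is proved only modulo the 7 printed citations until rung 0 closes.

## References

* [Kudla1994] S. S. Kudla, *Splitting metaplectic covers of dual reductive pairs*, Israel J. Math. 87 (1994) 361–401, §2 (the doubled
  space and its Siegel parabolic), Thm. 3.1.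
* [Kudla1984] S. Kudla, *Seesaw dual reductive pairs*, Progr. Math. 46 (1984), §1.
* [GelbartRogawski1991] S. Gelbart, J. Rogawski, *L-functions and Fourier–Jacobi coefficients for the unitary group U(3)*,
  Invent. Math. 105 (1991), §3.1 p. 454, Prop. 3.1.1 p. 455 L1–2.
* [MoeglinVignerasWaldspurger1987] C. Mœglin, M.-F. Vignéras, J.-L. Waldspurger, *Correspondances de Howe sur un corps p-adique*,
  LNM 1291 (1987), Chap. 2 II.1 (B).
* [HarrisKudlaSweet1996] M. Harris, S. Kudla, W. J. Sweet, J. Amer. Math. Soc. 9 (1996), §1 (1.14)–(1.15), Cor. A.3.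
* [Liu2021] Y. Liu, *Fourier–Jacobi cycles and arithmetic relative trace formula*, Camb. J. Math. 9 (2021), Def. 4.11, App. D §D.1 Step 2.
-/

set_option autoImplicit false

noncomputable section

open scoped Classical
open scoped Matrix Kronecker
open NumberField IsDedekindDomain
open Literature.RepresentationTheory.HeisenbergGroup
open Literature.NumberTheory.Automorphic
open Literature.NumberTheory.Weil1964
open Literature.NumberTheory.GaloisRepresentations
open Literature.RepresentationTheory.HarrisKudlaSweet1996

namespace Literature.NumberTheory.GelbartRogawski1991.GRConstruction

open UnitaryDualPair
open Literature.NumberTheory.Automorphic.UnitaryGroup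
open Literature.NumberTheory.Automorphic.Liu2021.Def411WeilCarriersDoubling

variable (L : Type) [Field L] [NumberField L] [IsCMField L]
  {N M n : ℕ} (e : Fin N × Fin M ≃ Fin n)
  (dV : Fin N → L) (hdV : ∀ i, IsCMField.complexConj L (dV i) = dV i) (hdV0 : ∀ i, dV i ≠ 0)
  (dV' : Fin N → L) (hdV' : ∀ i, IsCMField.complexConj L (dV' i) = dV' i) (hdV'0 : ∀ i, dV' i ≠ 0)
  (dW : Fin M → L) (hdW : ∀ i, IsCMField.complexConj L (dW i) = dW i) (hdW0 : ∀ i, dW i ≠ 0)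

/-! ## §1 Index `Fin n`: `χSplitting[dV′] = conjSplitting r C (χSplitting[dV] ∘ θ)` from the doubled equality -/

variable {L e dV hdV hdV0 dW hdW hdW0} in
/-- `undouble` depends on the doubled homomorphism only through its value (congruence along `sD₁ = sD₂`). [folklore] -/
private theorem undouble_congr {sD₁ sD₂ : HA L e dV hdV dW hdW →* MpD L e dV hdV dW hdW} (h : sD₁ = sD₂)
    (hproj₁ : ∀ x, projD L e dV hdV dW hdW (sD₁ x) = toSpD L e dV hdV dW hdW x)
    (hproj₂ : ∀ x, projD L e dV hdV dW hdW (sD₂ x) = toSpD L e dV hdV dW hdW x)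
    (g : adelicPair (Fp L) L (IsCMField.complexConj L) N M (Matrix.diagonal dV) (Matrix.diagonal dW)) :
    undouble L e dV hdV hdV0 dW hdW hdW0 hproj₁ g = undouble L e dV hdV hdV0 dW hdW hdW0 hproj₂ g := by
  subst h
  rfl

include hdV'0 in
/-- **the χ-attached splitting at `dV′` IS the conjugated χ-attached splitting at `dV`** — abstract doubled datum `(rD, CD, θD)`
with the (T4) equality `hT4`, abstract undoubled datum `(r, C, θ)` with (T4u)'s compatibilities `hθ / hsq / hrD`:
`χSplitting[dV′] g′ = conjSplitting r C hC (χSplitting[dV] ∘ θ) g′` ((T4u) `undouble_conjSplitting_comp` at `sD := doubledWeilRep[dV] χ`).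
[cite: Kudla1994, §2 (doubled space, Siegel parabolic), Thm. 3.1] [cite: GelbartRogawski1991, §3.1 Prop. 3.1.1 p. 455 L1–2] -/
theorem chiSplitting_eq_conjSplitting_of_doubled (χ : HeckeCharacter L) (hχu : χ.IsUnitary) (hχs : IsSplittingChar L 1 χ)
    (rD : MpD L e dV hdV dW hdW) (CD : GL (Fin (n + n)) (AdeleRing (𝓞 (Fp L)) (Fp L)))
    (hCD : gramDA L e dV hdV dW hdW * (CD : Matrix (Fin (n + n)) (Fin (n + n)) (AdeleRing (𝓞 (Fp L)) (Fp L))) = gramDA L e dV' hdV' dW hdW)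
    (θD : HA L e dV' hdV' dW hdW →* HA L e dV hdV dW hdW)
    (hT4 : conjSplitting (Fp L) (Fin (n + n)) rD CD hCD
        ((doubledWeilRep L e dV hdV hdV0 dW hdW hdW0 χ hχu hχs).comp θD) =
      doubledWeilRep L e dV' hdV' hdV'0 dW hdW hdW0 χ hχu hχs)
    (θ : adelicPair (Fp L) L (IsCMField.complexConj L) N M (Matrix.diagonal dV') (Matrix.diagonal dW) →*
      adelicPair (Fp L) L (IsCMField.complexConj L) N M (Matrix.diagonal dV) (Matrix.diagonal dW))
    (hθ : ∀ g', θD (inlG L e dV' hdV' dW hdW g') = inlG L e dV hdV dW hdW (θ g'))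
    (r : adelicMpCont (Fp L) (Fin n) (gramA L e dV hdV dW hdW)) (C : GL (Fin n) (AdeleRing (𝓞 (Fp L)) (Fp L)))
    (hC : gramA L e dV hdV dW hdW * (C : Matrix (Fin n) (Fin n) (AdeleRing (𝓞 (Fp L)) (Fp L))) = gramA L e dV' hdV' dW hdW)
    (hsq : ∀ g', adelicMpCont.proj (Fp L) (Fin n) (gramA L e dV hdV dW hdW) r *
        symplecticGroupCongr (polar (adelicForm (Fp L) (Fin n) (gramA L e dV' hdV' dW hdW)))
          (polar (adelicForm (Fp L) (Fin n) (gramA L e dV hdV dW hdW)))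
          (relabelVec (Fp L) (Fin n) C) (polar_relabelVec (Fp L) (Fin n) C hC) ((D L e dV' hdV' hdV'0 dW hdW hdW0).toSp g') *
      (adelicMpCont.proj (Fp L) (Fin n) (gramA L e dV hdV dW hdW) r)⁻¹ = (D L e dV hdV hdV0 dW hdW hdW0).toSp (θ g'))
    (B : piSchwartzBruhat (Fp L) (Fin n) ≃ₗ[ℂ] piSchwartzBruhat (Fp L) (Fin n))
    (hrD : ∀ Φ₁ Φ₂ : piSchwartzBruhat (Fp L) (Fin n),
      adelicMpCont.omega (Fp L) (Fin n ⊕ Fin n) (gramS L e dV hdV dW hdW) (undoubleIdx L e dV hdV dW hdW rD)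
          (tensorToSum (Fp L) (Fin n) (Fin n) Φ₁ Φ₂) =
        tensorToSum (Fp L) (Fin n) (Fin n) (adelicMpCont.omega (Fp L) (Fin n) (gramA L e dV hdV dW hdW) r Φ₁) (B Φ₂))
    (g' : adelicPair (Fp L) L (IsCMField.complexConj L) N M (Matrix.diagonal dV') (Matrix.diagonal dW)) :
    chiSplitting L e dV' hdV' hdV'0 dW hdW hdW0 χ hχu hχs g' =
      conjSplitting (Fp L) (Fin n) r C hC ((chiSplitting L e dV hdV hdV0 dW hdW hdW0 χ hχu hχs).comp θ) g' := by
  -- `π′ ∘ conjSplitting rD CD hCD (sD ∘ θD) = ι′^𝔻`, read off `hT4` and `doubledWeilRep[dV′] χ` being over `ι′^𝔻`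
  have hproj' : ∀ h, projD L e dV' hdV' dW hdW (conjSplitting (Fp L) (Fin (n + n)) rD CD hCD
      ((doubledWeilRep L e dV hdV hdV0 dW hdW hdW0 χ hχu hχs).comp θD) h) = toSpD L e dV' hdV' dW hdW h := fun h =>
    (congrArg (fun s : HA L e dV' hdV' dW hdW →* MpD L e dV' hdV' dW hdW => projD L e dV' hdV' dW hdW (s h)) hT4).trans
      ((isDoubledWeilRep_doubledWeilRep L e dV' hdV' hdV'0 dW hdW hdW0 χ hχu hχs).proj_eq h)
  -- `χSplitting[dV′] g′ = undouble[dV′] (doubledWeilRep[dV′] χ) g′ = undouble[dV′] (conjSplitting … (sD ∘ θD)) g′` (congruence along `hT4`)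
  have h1 : chiSplitting L e dV' hdV' hdV'0 dW hdW hdW0 χ hχu hχs g' =
      undouble L e dV' hdV' hdV'0 dW hdW hdW0 hproj' g' :=
    undouble_congr hT4.symm (isDoubledWeilRep_doubledWeilRep L e dV' hdV' hdV'0 dW hdW hdW0 χ hχu hχs).proj_eq hproj' g'
  -- (T4u)
  exact h1.trans (undouble_conjSplitting_comp
    (isDoubledWeilRep_doubledWeilRep L e dV hdV hdV0 dW hdW hdW0 χ hχu hχs).proj_eq rD CD hCD θD hproj' θ hθ r C hC hsq B hrD g')

/-! ## §2 The operator identities: `Fin n`, then the Kronecker index along `r = reindex_e rK` -/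

/-- **`ω(r) (ω(χSplitting[dV′] g′) Ψ) = ω(χSplitting[dV] (θ g′)) (ω(r) Ψ)`** from `χSplitting[dV′] = conjSplitting r C _ (χSplitting[dV] ∘ θ)`
(★ `omega_apply_omega_conjSplitting`). [cite: MoeglinVignerasWaldspurger1987, Chap. 2 II.1 (B)] [cite: Kudla1984, §1] -/
theorem omega_apply_omega_chiSplitting_of_eq_conjSplitting (χ : HeckeCharacter L) (hχu : χ.IsUnitary) (hχs : IsSplittingChar L 1 χ)
    (θ : adelicPair (Fp L) L (IsCMField.complexConj L) N M (Matrix.diagonal dV') (Matrix.diagonal dW) →*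
      adelicPair (Fp L) L (IsCMField.complexConj L) N M (Matrix.diagonal dV) (Matrix.diagonal dW))
    (r : adelicMpCont (Fp L) (Fin n) (gramA L e dV hdV dW hdW)) (C : GL (Fin n) (AdeleRing (𝓞 (Fp L)) (Fp L)))
    (hC : gramA L e dV hdV dW hdW * (C : Matrix (Fin n) (Fin n) (AdeleRing (𝓞 (Fp L)) (Fp L))) = gramA L e dV' hdV' dW hdW)
    (hU : ∀ g', chiSplitting L e dV' hdV' hdV'0 dW hdW hdW0 χ hχu hχs g' =
      conjSplitting (Fp L) (Fin n) r C hC ((chiSplitting L e dV hdV hdV0 dW hdW hdW0 χ hχu hχs).comp θ) g')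
    (g' : adelicPair (Fp L) L (IsCMField.complexConj L) N M (Matrix.diagonal dV') (Matrix.diagonal dW))
    (Ψ : piSchwartzBruhat (Fp L) (Fin n)) :
    adelicMpCont.omega (Fp L) (Fin n) (gramA L e dV hdV dW hdW) r
        (adelicMpCont.omega (Fp L) (Fin n) (gramA L e dV' hdV' dW hdW)
          (chiSplitting L e dV' hdV' hdV'0 dW hdW hdW0 χ hχu hχs g') Ψ) =
      adelicMpCont.omega (Fp L) (Fin n) (gramA L e dV hdV dW hdW)
        (chiSplitting L e dV hdV hdV0 dW hdW hdW0 χ hχu hχs (θ g'))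
        (adelicMpCont.omega (Fp L) (Fin n) (gramA L e dV hdV dW hdW) r Ψ) :=
  (congrArg (fun m : adelicMpCont (Fp L) (Fin n) (gramA L e dV' hdV' dW hdW) =>
      adelicMpCont.omega (Fp L) (Fin n) (gramA L e dV hdV dW hdW) r
        (adelicMpCont.omega (Fp L) (Fin n) (gramA L e dV' hdV' dW hdW) m Ψ)) (hU g')).trans
    (omega_apply_omega_conjSplitting (Fp L) (Fin n) r C hC
      ((chiSplitting L e dV hdV hdV0 dW hdW hdW0 χ hχu hχs).comp θ) g' Ψ)

/-- **the Kronecker-index form** (T-head `hω` shape, LANE currency): for `rK ∈ Mp_ψ(𝕎_{T_V ⊗ T_W})ᶜᵒⁿᵗ` with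
`χSplitting[dV′] = conjSplitting (reindex_e rK) C _ (χSplitting[dV] ∘ θ)`,
`ω(rK) (R_e⁻¹ (ω(χSplitting[dV′] g′) (R_e Ψ))) = R_e⁻¹ (ω(χSplitting[dV] (θ g′)) (R_e (ω(rK) Ψ)))` (★ `omega_reindex_apply`).
[cite: GelbartRogawski1991, §3.1 p. 454] [cite: MoeglinVignerasWaldspurger1987, Chap. 2 II.1 (B)] -/
theorem omega_kron_chiSplitting_of_eq_conjSplitting (χ : HeckeCharacter L) (hχu : χ.IsUnitary) (hχs : IsSplittingChar L 1 χ)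
    (θ : adelicPair (Fp L) L (IsCMField.complexConj L) N M (Matrix.diagonal dV') (Matrix.diagonal dW) →*
      adelicPair (Fp L) L (IsCMField.complexConj L) N M (Matrix.diagonal dV) (Matrix.diagonal dW))
    (rK : adelicMpCont (Fp L) (Fin N × Fin M)
      ((realDiagonal L dV hdV).map (algebraMap (Fp L) (AdeleRing (𝓞 (Fp L)) (Fp L))) ⊗ₖ (realDiagonal L dW hdW).map (algebraMap (Fp L) (AdeleRing (𝓞 (Fp L)) (Fp L)))))
    (C : GL (Fin n) (AdeleRing (𝓞 (Fp L)) (Fp L))) (hC : gramA L e dV hdV dW hdW * (C : Matrix (Fin n) (Fin n) (AdeleRing (𝓞 (Fp L)) (Fp L))) = gramA L e dV' hdV' dW hdW)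
    (hU : ∀ g', chiSplitting L e dV' hdV' hdV'0 dW hdW hdW0 χ hχu hχs g' =
      conjSplitting (Fp L) (Fin n) (adelicMpContReindex (Fp L) e _ rK) C hC
        ((chiSplitting L e dV hdV hdV0 dW hdW hdW0 χ hχu hχs).comp θ) g')
    (g' : adelicPair (Fp L) L (IsCMField.complexConj L) N M (Matrix.diagonal dV') (Matrix.diagonal dW))
    (Ψ : piSchwartzBruhat (Fp L) (Fin N × Fin M)) :
    adelicMpCont.omega (Fp L) (Fin N × Fin M) _ rK
        ((piSBReindex (Fp L) e).symm (adelicMpCont.omega (Fp L) (Fin n) (gramA L e dV' hdV' dW hdW)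
          (chiSplitting L e dV' hdV' hdV'0 dW hdW hdW0 χ hχu hχs g') (piSBReindex (Fp L) e Ψ))) =
      (piSBReindex (Fp L) e).symm (adelicMpCont.omega (Fp L) (Fin n) (gramA L e dV hdV dW hdW)
        (chiSplitting L e dV hdV hdV0 dW hdW hdW0 χ hχu hχs (θ g'))
        (piSBReindex (Fp L) e (adelicMpCont.omega (Fp L) (Fin N × Fin M) _ rK Ψ))) := by
  -- the `Fin n` identity at `Ψ′ := R_e Ψ`, with `ω(reindex_e rK) X = R_e (ω(rK) (R_e⁻¹ X))` on both sides
  -- (congruences threaded by hand: `rw` with the open pattern `ω (reindex ?p)` runs into the `isDefEq` cliff on `χSplitting g′`)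
  have h := omega_apply_omega_chiSplitting_of_eq_conjSplitting L e dV hdV hdV0 dV' hdV' hdV'0 dW hdW hdW0 χ hχu hχs θ
    (adelicMpContReindex (Fp L) e _ rK) C hC hU g' (piSBReindex (Fp L) e Ψ)
  have e1 := adelicMpCont.omega_reindex_apply (Fp L) e
    ((realDiagonal L dV hdV).map (algebraMap (Fp L) (AdeleRing (𝓞 (Fp L)) (Fp L))) ⊗ₖ (realDiagonal L dW hdW).map (algebraMap (Fp L) (AdeleRing (𝓞 (Fp L)) (Fp L)))) rK
    (adelicMpCont.omega (Fp L) (Fin n) (gramA L e dV' hdV' dW hdW)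
      (chiSplitting L e dV' hdV' hdV'0 dW hdW hdW0 χ hχu hχs g') (piSBReindex (Fp L) e Ψ))
  have e2 := adelicMpCont.omega_reindex_apply (Fp L) e
    ((realDiagonal L dV hdV).map (algebraMap (Fp L) (AdeleRing (𝓞 (Fp L)) (Fp L))) ⊗ₖ (realDiagonal L dW hdW).map (algebraMap (Fp L) (AdeleRing (𝓞 (Fp L)) (Fp L)))) rK
    (piSBReindex (Fp L) e Ψ)
  have e2' : adelicMpCont.omega (Fp L) (Fin n) (gramA L e dV hdV dW hdW) (adelicMpContReindex (Fp L) e _ rK)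
        (piSBReindex (Fp L) e Ψ) =
      piSBReindex (Fp L) e (adelicMpCont.omega (Fp L) (Fin N × Fin M) _ rK Ψ) :=
    e2.trans (congrArg (fun x => piSBReindex (Fp L) e (adelicMpCont.omega (Fp L) (Fin N × Fin M) _ rK x))
      ((piSBReindex (Fp L) e).symm_apply_apply Ψ))
  exact ((piSBReindex (Fp L) e).symm_apply_apply _).symm.trans
    (((congrArg (piSBReindex (Fp L) e).symm (e1.symm.trans h))).trans
      (congrArg (fun y => (piSBReindex (Fp L) e).symm (adelicMpCont.omega (Fp L) (Fin n) (gramA L e dV hdV dW hdW)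
        (chiSplitting L e dV hdV hdV0 dW hdW hdW0 χ hχu hχs (θ g')) y)) e2'))

end Literature.NumberTheory.GelbartRogawski1991.GRConstruction

end
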